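import Mathlib.MeasureTheory.Integral.Bochner.Basic
import Mathlib.MeasureTheory.Integral.IntegrableOn
import Mathlib.Topology.ContinuousMap.Bounded.Normed
import Mathlib.Topology.MetricSpace.HausdorffDistance
import HarnessLib

/-!
# Closed constraints pass to joint limits in law `(X_k, v_k) ⇒ (S, w S)`

Topic `Literature/Probability/Distributions`; a glue lemma of weak-convergence bookkeeping in the
setting of `JointLawTruncatedLimit.lean` / `JointLawTruncatedLimitGlue.lean`, written for the
limit passage of ANTITONICITY IN THE CUTOFF of the Garban–Pete–Schramm pivotal measures of
lattice models (route `Summits/CriticalPhenomena/CardyFormulaZ2/Theses/CardyMeckeFlip`, crux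
`FlipErgodicityZ2`, stub "the pivotal kernel of a bond-`ℤ²` sublimit exists and is admissible",
clause (ADM)(2)), but model-free.

**Setting.**  Random elements `X_k : Ω → E` of a topological Borel space and random elements
`v_k : Ω → V` of a second-countable pseudo-metric space (in the application `V = ℝ^m`, the
vector of integrals of finitely many test functions against finitely many random measures); a
finite Borel measure `μ` on `E` and a measurable `w : E → V`; the pairs `(X_k, v_k)` converge
"in law" to `(S, w S)`, `S ∼ μ`, in the functional form
`∫ G(X_k, v_k) dP → ∫ G(S, w S) dμ(S)` for every bounded continuous `G : E × V → ℝ` — the form in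
which `IsZ2PivotalKernelLimit` (`Literature/Probability/Percolation/Z2PivotalMeasure.lean`) states
the joint convergence of a configuration and its pivotal measure, the limit random element being
a FUNCTION of the limit configuration.

**Results.**
* `ae_mem_of_isClosed_of_tendsto_pair` — **closed constraints pass to the limit almost surely**:
  if `R ⊆ V` is closed and `v_k ∈ R` almost surely for all large `k`, then `w S ∈ R` for
  `μ`-a.e. `S` (test against the bounded continuous `min 1 (dist(·, R))`, whose lattice integrals
  vanish, so that its limit integral vanishes);
* corollaries in coordinates of `V = ℝ^m`: `ae_le_of_tendsto_pair` (inequalities between two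
  coordinates — the limit passage of antitonicity), `ae_nonneg_of_tendsto_pair`,
  `ae_apply_eq_zero_of_tendsto_pair` (zero sets of continuous functions, e.g. linear relations,
  cf. `ae_eq_sub_of_tendsto_triple` of `Z2PivotalCampbellLimit.lean`).

No named fact; Mathlib only.

## References

* P. Billingsley, *Convergence of Probability Measures*, 2nd ed. (1999), Thm. 2.1 (portmanteau,
  closed sets) — of which this is the graph-supported special case, proved directly.
-/

noncomputable section

open Set Filter Metric
open _root_.MeasureTheory _root_.Topology
open scoped ENNReal

namespace Literature.Probability.Distributions

section ClosedConstraint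

variable {Ω E V : Type*} [MeasurableSpace Ω] {P : Measure Ω}
  [TopologicalSpace E] [MeasurableSpace E] {μ : Measure E} [IsFiniteMeasure μ]
  [PseudoMetricSpace V] {X : ℕ → Ω → E} {v : ℕ → Ω → V} {w : E → V}

/-- If all limit integrals `∫ G(S, w S) dμ` of bounded continuous `G` vanish, then `μ = 0`
(test against the constant `1`). [folklore] -/
theorem measure_eq_zero_of_forall_integral_eq_zero
    (h : ∀ G : BoundedContinuousFunction (E × V) ℝ, ∫ S, G (S, w S) ∂μ = 0) : μ = 0 := by
  have h1 := h 1
  simp only [BoundedContinuousFunction.coe_one, Pi.one_apply, integral_const, smul_eq_mul,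
    mul_one] at h1
  rw [← Measure.measure_univ_eq_zero]
  have : μ.real univ = 0 := h1
  exact (measureReal_eq_zero_iff (measure_ne_top μ _)).1 this

/-- **Closed constraints pass to joint limits in law, almost surely.**  Let `(X_k, v_k)`
converge jointly in law to `(S, w S)`, `S ∼ μ`, in the functional form
`∫ G(X_k, v_k) dP → ∫ G(S, w S) dμ` for every bounded continuous `G : E × V → ℝ`, with `w`
measurable.  If `R ⊆ V` is closed and `v_k ∈ R` almost surely for all large `k`, then
`w S ∈ R` for `μ`-almost every `S`.  (Test against `G(S, x) = min 1 (dist(x, R))`: bounded,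
continuous, non-negative, vanishing exactly on `R`; its integrals along the sequence vanish,
hence so does `∫ min 1 (dist(w S, R)) dμ`.) [folklore] -/
theorem ae_mem_of_isClosed_of_tendsto_pair [OpensMeasurableSpace E] [SecondCountableTopology V]
    [MeasurableSpace V] [OpensMeasurableSpace V]
    (h : ∀ G : BoundedContinuousFunction (E × V) ℝ,
      Tendsto (fun k => ∫ ω, G (X k ω, v k ω) ∂P) atTop (𝓝 (∫ S, G (S, w S) ∂μ)))
    (hw : Measurable w) {R : Set V} (hR : IsClosed R) (hv : ∀ᶠ k in atTop, ∀ᵐ ω ∂P, v k ω ∈ R) :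
    ∀ᵐ S ∂μ, w S ∈ R := by
  rcases R.eq_empty_or_nonempty with rfl | hRne
  · -- `R = ∅`: then `P = 0` for large `k`, all limit integrals vanish, `μ = 0`
    have hzero : ∀ G : BoundedContinuousFunction (E × V) ℝ, ∫ S, G (S, w S) ∂μ = 0 := by
      intro G
      refine tendsto_nhds_unique (h G) (tendsto_const_nhds.congr' ?_)
      filter_upwards [hv] with k hk
      have hP : P = 0 := by
        rw [← Measure.measure_univ_eq_zero]
        have : ∀ᵐ ω ∂P, ω ∉ (univ : Set Ω) := hk.mono fun ω hω _ => hω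
        exact measure_eq_zero_iff_ae_notMem.2 this
      rw [hP, integral_zero_measure]
    rw [measure_eq_zero_of_forall_integral_eq_zero hzero, ae_zero]
    exact eventually_bot
  -- the test function
  set D : E × V → ℝ := fun p => min 1 (infDist p.2 R) with hD
  have hDc : Continuous D :=
    continuous_const.min ((continuous_infDist_pt (s := R)).comp continuous_snd)
  have hD0 : ∀ p, 0 ≤ D p := fun p => le_min zero_le_one infDist_nonneg
  have hD1 : ∀ p, ‖D p‖ ≤ 1 := fun p => by
    rw [Real.norm_eq_abs, abs_of_nonneg (hD0 p)]
    exact min_le_left _ _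
  set G : BoundedContinuousFunction (E × V) ℝ :=
    BoundedContinuousFunction.ofNormedAddCommGroup D hDc 1 hD1 with hG
  have hGD : ∀ p, G p = D p := fun p => rfl
  -- its integrals along the sequence vanish eventually
  have hk : ∀ᶠ k in atTop, ∫ ω, G (X k ω, v k ω) ∂P = 0 := by
    filter_upwards [hv] with k hk
    have h0 : (fun ω => G (X k ω, v k ω)) =ᵐ[P] fun _ => 0 := by
      filter_upwards [hk] with ω hω
      rw [hGD, hD]
      simp only [infDist_zero_of_mem hω]
      exact min_eq_right zero_le_one
    rw [integral_congr_ae h0, integral_zero]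
  -- hence so does the limit integral
  have hlim : ∫ S, G (S, w S) ∂μ = 0 :=
    tendsto_nhds_unique (h G) (tendsto_const_nhds.congr' (hk.mono fun k hk => hk.symm))
  have hmeas : Measurable fun S => G (S, w S) :=
    G.continuous.measurable.comp (measurable_id.prodMk hw)
  have hint : Integrable (fun S => G (S, w S)) μ :=
    Integrable.of_bound hmeas.aestronglyMeasurable 1 (ae_of_all _ fun S => hD1 _)
  have hae := (integral_eq_zero_iff_of_nonneg (fun S => hD0 _) hint).1 hlim
  filter_upwards [hae] with S hS
  have h1 : min 1 (infDist (w S) R) = 0 := hS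
  have h2 : infDist (w S) R = 0 := by
    rcases min_choice (1 : ℝ) (infDist (w S) R) with h' | h'
    · rw [h'] at h1; exact absurd h1 one_ne_zero
    · rwa [h'] at h1
  exact (hR.mem_iff_infDist_zero hRne).2 h2

end ClosedConstraint

/-! ### Coordinates of `V = ℝ^m` -/

section Coordinates

variable {Ω E : Type*} [MeasurableSpace Ω] {P : Measure Ω}
  [TopologicalSpace E] [MeasurableSpace E] [OpensMeasurableSpace E] {μ : Measure E}
  [IsFiniteMeasure μ] {m : ℕ} {X : ℕ → Ω → E} {v : ℕ → Ω → Fin m → ℝ} {w : E → Fin m → ℝ}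

/-- **Inequalities between lattice functionals pass to the joint limit almost surely** (the
limit passage of antitonicity in the cutoff): if `(X_k, v_k) ⇒ (S, w S)` jointly (bounded
continuous test functions of `E × ℝ^m`) and `v_kⁱ ≤ v_kʲ` almost surely for all large `k`, then
`wⁱ ≤ wʲ` `μ`-almost surely. [folklore] -/
theorem ae_le_of_tendsto_pair
    (h : ∀ G : BoundedContinuousFunction (E × (Fin m → ℝ)) ℝ,
      Tendsto (fun k => ∫ ω, G (X k ω, v k ω) ∂P) atTop (𝓝 (∫ S, G (S, w S) ∂μ)))
    (hw : ∀ j, Measurable fun S => w S j) (i j : Fin m)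
    (hv : ∀ᶠ k in atTop, ∀ᵐ ω ∂P, v k ω i ≤ v k ω j) :
    ∀ᵐ S ∂μ, w S i ≤ w S j :=
  ae_mem_of_isClosed_of_tendsto_pair h (measurable_pi_iff.2 hw) (R := {x | x i ≤ x j})
    (isClosed_le (continuous_apply i) (continuous_apply j)) hv

/-- Non-negativity of a lattice functional passes to the joint limit almost surely. [folklore] -/
theorem ae_nonneg_of_tendsto_pair
    (h : ∀ G : BoundedContinuousFunction (E × (Fin m → ℝ)) ℝ,
      Tendsto (fun k => ∫ ω, G (X k ω, v k ω) ∂P) atTop (𝓝 (∫ S, G (S, w S) ∂μ)))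
    (hw : ∀ j, Measurable fun S => w S j) (i : Fin m)
    (hv : ∀ᶠ k in atTop, ∀ᵐ ω ∂P, 0 ≤ v k ω i) :
    ∀ᵐ S ∂μ, 0 ≤ w S i :=
  ae_mem_of_isClosed_of_tendsto_pair h (measurable_pi_iff.2 hw) (R := {x | 0 ≤ x i})
    (isClosed_le continuous_const (continuous_apply i)) hv

/-- **Continuous relations among lattice functionals pass to the joint limit almost surely**:
for a continuous `f : ℝ^m → ℝ`, if `f (v_k) = 0` almost surely for all large `k`, then
`f (w S) = 0` for `μ`-a.e. `S` (e.g. linear relations, cf. `ae_eq_sub_of_tendsto_triple`).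
[folklore] -/
theorem ae_apply_eq_zero_of_tendsto_pair
    (h : ∀ G : BoundedContinuousFunction (E × (Fin m → ℝ)) ℝ,
      Tendsto (fun k => ∫ ω, G (X k ω, v k ω) ∂P) atTop (𝓝 (∫ S, G (S, w S) ∂μ)))
    (hw : ∀ j, Measurable fun S => w S j) {f : (Fin m → ℝ) → ℝ} (hf : Continuous f)
    (hv : ∀ᶠ k in atTop, ∀ᵐ ω ∂P, f (v k ω) = 0) :
    ∀ᵐ S ∂μ, f (w S) = 0 :=
  ae_mem_of_isClosed_of_tendsto_pair h (measurable_pi_iff.2 hw) (R := f ⁻¹' {0})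
    (isClosed_singleton.preimage hf) hv

end Coordinates

end Literature.Probability.Distributions

end
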